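import Summits.HodgeConjecture.HodgeConjecture.Theorems.EndoscopicMiddleDegreeMiddleDegreeStepIffBlocks

/-!
# Line `core-splitting-ladder` — checked skeleton for crux `EndoscopicMiddleDegree.AlgebraicOrEnveloped` (rev 9)
(item stmt-HodgeConjecture-14943, route route-HodgeConjecture-EndoscopicMiddleDegree; crux-plan round 1, idea card
`Cruxes/AlgebraicOrEnveloped/Ideas/core-splitting-ladder.md`, triage r1-1 pass, r1-2 pass; planner
planner-cruxplan-stmt-HodgeConjecture-14943-core-splitting-ladde-0; leads a1 (cycle 1, rev 1–4), c3 (cycle 2, rev 5–7), c4 (cycle 3,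
rev 8), c5 (cycle 4, rev 9); 2026-08-16)

THE CRUX (rank 5, THE DICHOTOMY; decl `Summit.HodgeConjecture.HodgeConjecture.Theses.EndoscopicMiddleDegree.AlgebraicOrEnveloped`,
never restated here): for `m ∈ {1,2}` (`n = m+1`), a datum `D : UnitaryBallQuotientDatum (2n) X` and HC in degree `2m` on `X`,
every rational Hodge `(n,n)`-class lies in `algebraicClasses X n ⊔ span {e rational : ∃ μ γ, P_γ rational-preserving, (n,n)-valued,
P_γ e = e}`.

## The line in one paragraph (as it stands after three lead cycles): ONE STUB, THE BET

Write a rational Hodge `(n,n)`-class `c` as `Σ_ε ε c` over the ℚ-BLOCKS `ε` of the Hecke algebra `𝓗 = Algebra.adjoin ℂ (range T_g)`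
on `H²ⁿ(X(ℂ); ℂ)` (`stub_rationalBlocks` p87916: in `𝓗`, idempotent, central, rational-preserving, primitive among such, `Σ ε = 1`).
Every element of `𝓗` is the action `P_γ` of an ALGEBRAIC class `γ` on `X ⊗ X` (the sibling's Hecke ring `adjoin_hecke_le_span` +
`stub_heckeGraphAlgebraic` p112869 — no cup products) and preserves every Hodge type (`heckeHodgeType`, unconditional). Blockwise:
a PURE block's `ε c` is ENVELOPED by `γ_ε` itself (`P_{γ_ε} = ε` is rational-preserving, `(n,n)`-valued by purity, and fixes `ε c` by
idempotency); a KILLED impure block has `ε c = 0` (coefficient-conjugation sieve `stub_killedBarren` p96373); an UN-KILLED impure block —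
a CORE — has `ε c ∈ algebraicClasses X n` by THE BET (Stub 2). Hence the crux. This composition is LANDED
(`Theorems.CoreSplittingLadder.algebraicOrEnveloped_of_bet`, file `Theorems/EndoscopicMiddleDegreeAlgebraicOrEnvelopedOfBetAlone`,
p119631, registered stub `algebraicOrEnveloped_of_bet`): the crux is kernel-checked CLOSED MODULO THE BET AND NOTHING ELSE —
no `CupProductAlgebraic` (route item 14350), no Literature named fact, no Hodge–Riemann split. The line card's endoscopic LADDER
(narrow cores transported to `H²` of `B × A_Φ` / `S`, Lefschetz `(1,1)` at the bottom; wide cores tool-less) remains the recorded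
attack on the bet, not skeleton structure.

## Revision history (numbers)
rev 0 (planner): 6 stubs. rev 1–4 (lead a1, cycle 1): `stub_heckeGraphAlgebraic` LANDED p112869, `stub_corrActionAdjoint` LANDED
p116389, `stub_lefschetzOneOne` retired (derivable), Kähler package discharged upstream p113954, transporter pair recut to the
cycle-construction stubs B (narrow) / C (wide); 3 sorries. rev 5–7 (lead c3, cycle 2): durable composition p117869 (crux ⟸ coniveau +
`CupProductAlgebraic` + bet), calibration p117875 (bet ⟸ target `MiddleDegreeStep`; bet ⟸ 14300's `stub_coreVanishing` + facts;
coniveau-free p118732), pure-coniveau refinement p118246, `stub_algebraicClassesHodge` LANDED p118920 over the tree's Prop. 11.20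
(p118251); 2 sorries: `stub_cupProductAlgebraic` (item 14350 by name) · the bet. rev 8 (lead c4, cycle 3): the rev-5/7 composition
routed the bet through the dead line's glue p106212 ("envelope the `Alg`-orthogonal remainder"), the only consumer of cup products
(cup-adjoint closure of `𝓗`, `P_γ(Alg) ⊆ Alg`, `Alg ∩ Alg^⊥ ∩ Hdg_ℚ = 0`); the bet as registered carries NO orthogonality hypothesis,
so the crux follows from it DIRECTLY by the block decomposition above — `algebraicOrEnveloped_of_bet` LANDED p119631;
`stub_cupProductAlgebraic` ELIMINATED (item 14350 is off this crux's path; it stays a route `Assembly` hypothesis); 1 sorry: the bet.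
rev 9 (lead c5, cycle 4): NO structural change (the skeleton is minimal: crux ⟸ bet alone; 1 sorry, the bet, not worker-sized, wave
impossible); calibration against the route's TARGET landed p121119 (`Theorems/EndoscopicMiddleDegreeMiddleDegreeStepIffBlocks`, imported):
`MiddleDegreeStep ⟺ PureBlockHodgeClassesAlgebraic ∧ bet` (fact-free blockwise decomposition), pure half ⟸ `IsotypicMiddleClassesAlgebraic`
(14301), hence TARGET ⟸ 14301 ∧ bet DIRECTLY — the crux `AlgebraicOrEnveloped` is a detour on the deciding path once the bet is an item.

## Disproof.lean obligations honoured (Cruxes/AlgebraicOrEnveloped/Disproof.lean, cdisprove cycle 1 CLOSED 12:40Z, F0–F7; `-- Targets` empty)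
F1 (ceiling: crux ⟸ target ⟸ HC; Negative/Calibration p98331): the one stub is HC-implied (p117875
`coreHodgeClassesAlgebraic_of_middleDegreeStep`), unrefutable short of ¬HC. F2 (`∃ μ` slack void): the composition supplies the complex
orientation family (`exists_orientationFamily_hasPoincareDuality`) under Theorems/, the route file constructs none. F3: "`γ` algebraic"
= Hecke ring + p112869; purity of `Im P` BY CONSTRUCTION (a pure block); F3(d) rationality preservation = ℚ-block property; F3(e) `hlow`
is handed whole to the bet (its only consumer now). F4-type hypotheses `IsRationalClass e`, `IsOfHodgeType e` kept in the bet and the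
sieve. F5/F5b (automorphic residue = cores): the bet, whole. Negatives index (stmt-11121, stmt-12555): unrelated; no stub restates the
crux, `MiddleDegreeStep`, `OrthogonalEnveloped`, the summit or a refuted statement.

## Calibration of the one stub (all landed; for the planner's promote / re-line decision; rev 9 adds p121119: TARGET ⟺ pure-block HC ∧ bet, TARGET ⟸ 14301 ∧ bet)
crux ⟺ "algebraic-or-enveloped for CORE-FIXED rational `(n,n)`-classes" (fact-free, `algebraicOrEnveloped_iff_coreFixed`, file
`Theorems/EndoscopicMiddleDegreeAlgebraicOrEnvelopedIffCores`, p120185: every proof of the crux is a proof about core classes, nothing else;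
the bet is the `Alg`-normalised strengthening of that right-hand side) ·
bet ⟸ `MiddleDegreeStep` (p117875, two lines) · crux ⟸ bet (p119631, this skeleton) · target ⟸ crux + `IsotypicMiddleClassesAlgebraic`
(route `closes`) — so granted the route's other crux 14301 the bet, the crux and the target are EQUIVALENT; bet ⟸ 14300's registered
`stub_coreVanishing` + `CupProductAlgebraic` (p118732) and `OrthogonalEnveloped` ⟸ `stub_coreVanishing` alone (sibling p-OfBetAlone):
the two lines' residues are the same automorphic statement "Hecke cores carry no non-algebraic rational `(n,n)`-class" in two
normalisations (ours: cores map `Hdg_ℚ` into `Alg`; theirs: cores kill `Hdg_ℚ ∩ TW(D)^⊥`).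
-/

noncomputable section

-- The crux-workfile namespace `Summit.<P>.<Sub>.Cruxes.…` repeats `HodgeConjecture` (single-conjunct summit).
set_option linter.dupNamespace false

namespace Summit.HodgeConjecture.HodgeConjecture.Cruxes.AlgebraicOrEnveloped.CoreSplittingLadder

open scoped BigOperators
open CategoryTheory MonoidalCategory CartesianMonoidalCategory
open Literature.AlgebraicGeometry.Motives (SchemeOver ComplexPoints IsSmoothProjective)
open Literature.AlgebraicGeometry.HodgeTheory
open Literature.AlgebraicGeometry.ShimuraVarieties
open Literature.AlgebraicTopology.SingularHomology
open Summit.HodgeConjecture.HodgeConjecture.Theses.EndoscopicMiddleDegree (AlgebraicOrEnveloped MiddleDegreeStep)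
open Summit.HodgeConjecture.HodgeConjecture.Cruxes.MiddleThetaSpan.ConjugateDimensionSieve (IsPrimitiveCentralIdempotent)
open Summit.HodgeConjecture.HodgeConjecture.Theorems.CoreSplittingLadder
  (algebraicOrEnveloped_of_bet middleDegreeStep_of_isotypicMiddle_of_bet middleDegreeStep_iff_blocks)
open Summit.HodgeConjecture.HodgeConjecture.Theorems.EndoscopicMiddleDegreeAlgebraicOrEnvelopedCoreHodgeClassesAlgebraicCalibration
  (coreHodgeClassesAlgebraic_of_middleDegreeStep)

/-! ## The registered stub -/

/-- **Stub 2 (lead rev 5–8; OPEN — THE BET: the Hodge conjecture on Hecke cores; the line's ONLY stub since rev 8).** Let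
`m ∈ {1,2}` (`n = m+1`), `D` a datum with HC in degree `2m` (`hlow`, free), `𝓗 = Algebra.adjoin ℂ (range T_g)` on
`H = H²ⁿ(X(ℂ); ℂ)`, and `ε` a ℚ-BLOCK of `𝓗` (in `𝓗`, idempotent, central, rational-preserving, Hodge-type-preserving, primitive
among the rational central idempotents — the shape of the landed `stub_rationalBlocks`) which is IMPURE and UN-KILLED (a CORE: some
ℂ-block `z ≤ ε` carries a non-zero `(n,n)`-class at every coefficient conjugate). CLAIM: `ε` maps every rational `(n,n)`-class INTO
`algebraicClasses X n`. STATUS (kernel-checked): implied by the route's target `MiddleDegreeStep` (p117875, two lines) — so HC-implied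
and unrefutable short of ¬HC (Disproof F1); implies the crux ALONE (p119631); implied by 14300's registered bet `stub_coreVanishing`
granted `CupProductAlgebraic` (p118732); implied by nothing in print (BMM Thm. 1/Cor. 2 exclude the middle degree `n = p/2`). ATTACK
(line card k-table, by reach of the core): narrow cores (`Ψ₂ ∋ 0` of parallel gap 1, centred `Ψ₃`) — realise `ε(H)(n-1)` inside
`H¹(B) ⊗ H¹(A_Φ) ⊂ H²(B × A_Φ)` resp. `H²(S)` by an Ichino–Prasanna-type isomorphism of Hodge structures (arXiv:1806.10563 Thm. 1 /
Rem. 1 (vii); unprinted for `(U(2n,1), U(a-1,1))`), where Faltings–Ribet / Blasius–Rogawski leave no rational Hodge class for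
non-CM / non-AI cores (then `ε e = 0 ∈ Alg`), and the CM / AI cores need the higher Blasius–Rogawski cycles (open); wide cores
(primitive `Ψ_{2n+1}`, non-contiguous blocks, `Ψ₄ ∋ 0 ⊞ χ₀`, …) — tool-less. WHY IT MIGHT FAIL: one rational `(2,2)`-class in one
core of one compact `U(4,1)`-quotient. [cite: BergeronMillsonMoeglin2016Balls, Part 2 §1.9 and Thm. 61] [cite: arXiv:1507.01432, §8]
[cite: arXiv:1806.10563, Thm. 1 and Remark 1 (vii)] [cite: zbl:0828.14012, Thm. 1] -/
theorem stub_coreHodgeClassesAlgebraic :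
    ∀ (m : ℕ) (X : SchemeOver ℂ) (D : UnitaryBallQuotientDatum (2 * (m + 1)) X), 1 ≤ m → m ≤ 2 →
      (∀ a : complexBetti X (2 * m), IsRationalClass a →
        IsOfHodgeType (2 * (m + 1)) X (2 * m) m m a → a ∈ algebraicClasses X m) →
      ∀ ε : Module.End ℂ (complexBetti X (2 * (m + 1))),
        ε ∈ Algebra.adjoin ℂ (Set.range (D.heckeCorrespondenceAction (2 * (m + 1)))) →
        ε * ε = ε →
        (∀ T ∈ Algebra.adjoin ℂ (Set.range (D.heckeCorrespondenceAction (2 * (m + 1)))),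
          T * ε = ε * T) →
        (∀ β, IsRationalClass β → IsRationalClass (ε β)) →
        (∀ (p q : ℕ) (x : complexBetti X (2 * (m + 1))), IsOfHodgeType (2 * (m + 1)) X (2 * (m + 1)) p q x →
          IsOfHodgeType (2 * (m + 1)) X (2 * (m + 1)) p q (ε x)) →
        (∀ f ∈ Algebra.adjoin ℂ (Set.range (D.heckeCorrespondenceAction (2 * (m + 1)))),
          f * f = f →
          (∀ T ∈ Algebra.adjoin ℂ (Set.range (D.heckeCorrespondenceAction (2 * (m + 1)))),
            T * f = f * T) →
          (∀ β, IsRationalClass β → IsRationalClass (f β)) → f * ε = 0 ∨ f * ε = ε) →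
        (∃ β, ¬ IsOfHodgeType (2 * (m + 1)) X (2 * (m + 1)) (m + 1) (m + 1) (ε β)) →
        (∃ z : Module.End ℂ (complexBetti X (2 * (m + 1))),
          IsPrimitiveCentralIdempotent
              (Algebra.adjoin ℂ (Set.range (D.heckeCorrespondenceAction (2 * (m + 1))))) z ∧
            z * ε = z ∧
              ∀ σ : ℂ ≃+* ℂ, ∃ c : complexBetti X (2 * (m + 1)),
                IsOfHodgeType (2 * (m + 1)) X (2 * (m + 1)) (m + 1) (m + 1) (conjEnd σ z c) ∧
                  conjEnd σ z c ≠ 0) →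
        ∀ e : complexBetti X (2 * (m + 1)), IsRationalClass e →
          IsOfHodgeType (2 * (m + 1)) X (2 * (m + 1)) (m + 1) (m + 1) e →
          ε e ∈ algebraicClasses X (m + 1) := by
  sorry

/-! ## The crux by name -/

/-- **`AlgebraicOrEnveloped` from the one registered stub** (rev 8): the landed `algebraicOrEnveloped_of_bet` (p119631: block
decomposition `c = Σ_ε ε c`; pure blocks self-envelope, killed blocks vanish by the sieve, cores by the bet) fed with Stub 2. -/
theorem AlgebraicOrEnveloped_of :
    Summit.HodgeConjecture.HodgeConjecture.Theses.EndoscopicMiddleDegree.AlgebraicOrEnveloped :=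
  algebraicOrEnveloped_of_bet stub_coreHodgeClassesAlgebraic

/-! ## Calibration of the stub (landed; recorded here for the disprover / consult / planner) -/

/-- Stub 2 (the bet) from the route's TARGET `MiddleDegreeStep` (p117875): the bet is HC-implied, unrefutable short of ¬HC. -/
example (h : MiddleDegreeStep) :
    ∀ (m : ℕ) (X : SchemeOver ℂ) (D : UnitaryBallQuotientDatum (2 * (m + 1)) X), 1 ≤ m → m ≤ 2 →
      (∀ a : complexBetti X (2 * m), IsRationalClass a →
        IsOfHodgeType (2 * (m + 1)) X (2 * m) m m a → a ∈ algebraicClasses X m) →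
      ∀ ε : Module.End ℂ (complexBetti X (2 * (m + 1))),
        ε ∈ Algebra.adjoin ℂ (Set.range (D.heckeCorrespondenceAction (2 * (m + 1)))) →
        ε * ε = ε →
        (∀ T ∈ Algebra.adjoin ℂ (Set.range (D.heckeCorrespondenceAction (2 * (m + 1)))),
          T * ε = ε * T) →
        (∀ β, IsRationalClass β → IsRationalClass (ε β)) →
        (∀ (p q : ℕ) (x : complexBetti X (2 * (m + 1))), IsOfHodgeType (2 * (m + 1)) X (2 * (m + 1)) p q x →
          IsOfHodgeType (2 * (m + 1)) X (2 * (m + 1)) p q (ε x)) →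
        (∀ f ∈ Algebra.adjoin ℂ (Set.range (D.heckeCorrespondenceAction (2 * (m + 1)))),
          f * f = f →
          (∀ T ∈ Algebra.adjoin ℂ (Set.range (D.heckeCorrespondenceAction (2 * (m + 1)))),
            T * f = f * T) →
          (∀ β, IsRationalClass β → IsRationalClass (f β)) → f * ε = 0 ∨ f * ε = ε) →
        (∃ β, ¬ IsOfHodgeType (2 * (m + 1)) X (2 * (m + 1)) (m + 1) (m + 1) (ε β)) →
        (∃ z : Module.End ℂ (complexBetti X (2 * (m + 1))),
          IsPrimitiveCentralIdempotent
              (Algebra.adjoin ℂ (Set.range (D.heckeCorrespondenceAction (2 * (m + 1))))) z ∧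
            z * ε = z ∧
              ∀ σ : ℂ ≃+* ℂ, ∃ c : complexBetti X (2 * (m + 1)),
                IsOfHodgeType (2 * (m + 1)) X (2 * (m + 1)) (m + 1) (m + 1) (conjEnd σ z c) ∧
                  conjEnd σ z c ≠ 0) →
        ∀ e : complexBetti X (2 * (m + 1)), IsRationalClass e →
          IsOfHodgeType (2 * (m + 1)) X (2 * (m + 1)) (m + 1) (m + 1) e →
          ε e ∈ algebraicClasses X (m + 1) :=
  coreHodgeClassesAlgebraic_of_middleDegreeStep h

/-- The target from the crux and the route's other crux `IsotypicMiddleClassesAlgebraic` (the body of the route's `closes`, two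
lines): with the two calibrations above, bet ⟹ crux ⟹ (granted 14301) target ⟹ bet — promoting the bet to an item costs the
route nothing and loses nothing. -/
example (h₁ : Summit.HodgeConjecture.HodgeConjecture.Theses.EndoscopicMiddleDegree.IsotypicMiddleClassesAlgebraic)
    (h₂ : AlgebraicOrEnveloped) : MiddleDegreeStep := by
  intro m X hm1 hm2 hD hlow c hc hH
  obtain ⟨D⟩ := hD
  refine (sup_le le_rfl ?_ : _ ≤ algebraicClasses X (m + 1)) (h₂ m X D hm1 hm2 hlow c hc hH)
  refine Submodule.span_le.2 ?_
  rintro e ⟨he, μ, hμ, γ, hγ, hrat, hhodge, hfix⟩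
  exact h₁ μ hμ m X D hm1 hm2 γ hγ hrat hhodge e he hfix

/-- (rev 9, p121119) The target from `IsotypicMiddleClassesAlgebraic` and Stub 2 DIRECTLY — by the blockwise decomposition, without
the crux: pure ℚ-blocks are handled by 14301 (their Hecke projector is an algebraic, rational-preserving, `(n,n)`-valued `P_γ`), killed
blocks by the sieve, cores by the bet. So once the bet is an item, `AlgebraicOrEnveloped` is not needed on the deciding path. -/
example (h₁ : Summit.HodgeConjecture.HodgeConjecture.Theses.EndoscopicMiddleDegree.IsotypicMiddleClassesAlgebraic) :
    MiddleDegreeStep :=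
  middleDegreeStep_of_isotypicMiddle_of_bet h₁ stub_coreHodgeClassesAlgebraic

/-- (rev 9, p121119) Loss-freeness of the blockwise reading: the target IS "HC on pure ℚ-Hecke blocks ∧ HC on Hecke cores" (the second
conjunct verbatim Stub 2), fact-free. -/
example (h : MiddleDegreeStep) :
    (∀ (m : ℕ) (X : SchemeOver ℂ) (D : UnitaryBallQuotientDatum (2 * (m + 1)) X), 1 ≤ m → m ≤ 2 →
      (∀ a : complexBetti X (2 * m), IsRationalClass a →
        IsOfHodgeType (2 * (m + 1)) X (2 * m) m m a → a ∈ algebraicClasses X m) →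
      ∀ ε : Module.End ℂ (complexBetti X (2 * (m + 1))),
        ε ∈ Algebra.adjoin ℂ (Set.range (D.heckeCorrespondenceAction (2 * (m + 1)))) →
        ε * ε = ε →
        (∀ T ∈ Algebra.adjoin ℂ (Set.range (D.heckeCorrespondenceAction (2 * (m + 1)))),
          T * ε = ε * T) →
        (∀ β, IsRationalClass β → IsRationalClass (ε β)) →
        (∀ (p q : ℕ) (x : complexBetti X (2 * (m + 1))), IsOfHodgeType (2 * (m + 1)) X (2 * (m + 1)) p q x →
          IsOfHodgeType (2 * (m + 1)) X (2 * (m + 1)) p q (ε x)) →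
        (∀ f ∈ Algebra.adjoin ℂ (Set.range (D.heckeCorrespondenceAction (2 * (m + 1)))),
          f * f = f →
          (∀ T ∈ Algebra.adjoin ℂ (Set.range (D.heckeCorrespondenceAction (2 * (m + 1)))),
            T * f = f * T) →
          (∀ β, IsRationalClass β → IsRationalClass (f β)) → f * ε = 0 ∨ f * ε = ε) →
        (∀ β, IsOfHodgeType (2 * (m + 1)) X (2 * (m + 1)) (m + 1) (m + 1) (ε β)) →
        ∀ e : complexBetti X (2 * (m + 1)), IsRationalClass e →
          IsOfHodgeType (2 * (m + 1)) X (2 * (m + 1)) (m + 1) (m + 1) e →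
          ε e ∈ algebraicClasses X (m + 1)) :=
  (middleDegreeStep_iff_blocks.1 h).1

end Summit.HodgeConjecture.HodgeConjecture.Cruxes.AlgebraicOrEnveloped.CoreSplittingLadder

end
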